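import Mathlib
import HarnessLib
import Summits.HubbardSuperconductivity.HubbardSuperconductivity.Theorems.KLProgrammeKLRegimeCountertermReadingFrame

/-!
# Route `KLProgramme` — the Counterterm child of crux K3 (gen-3 item stmt-HubbardSuperconductivity-19825 `KLRegimeCountertermV11`
# `:= CountertermP2 klPredsV11 klWindowC`; gen-2 stmt-…-19664): THE GATE LEMMA KEYED BY `FrameOK` IN THE KL REGIME
# (seat hubbard-kl-k3c3-p1, part E of `…CountertermMuFlow/MuFlowExt/Reading/ReadingFrame`)

Part D (`…CountertermReadingFrame`) reads `RenormalisedAtF L M β U μ K R n` off a uniform sup bound of the polynomial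
`K ⊕ Σ_{i ≤ n} ℓ_i^G(K)` under p4's EXPLICIT frame hypotheses (`B : BandBounds a b`, `C²`-size `A` of `frameShift K`, …).  The
one-volume construction (k3c3-p2's wholesale continuation of `CtOneVolumeMsV11`) holds its iterates as `FrameOK (ctRen …) U (nScales β) μ K`
in the regime `0 < c ≤ c₃`, `0 < U ≤ U₀`, `klBetaMin ≤ β ≤ e^{c/U²}`, `μ ∈ klWindowC`.  This module packages part D in exactly that key
(the pattern of p4's `contDiff_klLocalPart_of_frameOK` and k3c3-p3's `frameCurve_lipschitz_of_frameOK`): for every `R` with `Gfr ≥ 0` there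
are VOLUME/β/U/FRAME-FREE constants `c₃, U₀ > 0`, `Λ_K ≥ 0` (frame-on-curve Lipschitz budget) and `r₀ > 0` (Fermi-radius floor) such that,
in the regime, for every admissible frame, every volume `L ≥ max(20, 8π/klFlatR)` with `2π/L < r₀`, every scale `n` and every package `R′`:

  an angular Lipschitz constant `Λ_ν` of `ν_n(K)` ((E3g₁)), a sup-metric Lipschitz constant `Λ_ℓ` of `Σ_{i ≤ n} ℓ_i^G(K)` ((E3a) `j = 1`,
  k3c3-p3's `abs_eval_klTwoLegPieceG_sub_le_of_sizes`), a uniform sup bound `B₀` of `K ⊕ Σ_{i ≤ n} ℓ_i^G(K)` and the tolerance arithmetic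
  `B₀ + Λ_ℓ·2π/L + (Λ_ν + Λ_K)·π·(2π/L)/r₀ ≤ R′.cr·|U|·Λ_n²/e₀` give `RenormalisedAtF L M β U μ K R′ n`
  (`renormalisedAtF_of_partialSum_frameOK`; pointwise form `abs_klLocalPart_le_of_partialSum_frameOK`).

Proofs only; nothing is asserted about the Hubbard model.
-/

noncomputable section

namespace Summit.HubbardSuperconductivity.HubbardSuperconductivity.Theorems.KLRegimeSplit

set_option linter.dupNamespace false -- summit = problem name (single-conjunct summit), D-0017

open Real Finset MeasureTheory Set
open Literature.MathematicalPhysics.QuantumLattice Literature.Probability.LatticeModels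
open Literature.MathematicalPhysics.QuantumLattice.BandSectorCounting
open Summit.HubbardSuperconductivity.HubbardSuperconductivity.Theorems.KLProgrammeLegKernels
open Summit.HubbardSuperconductivity.HubbardSuperconductivity.Theorems.PerturbedFermiCurve
open Summit.HubbardSuperconductivity.HubbardSuperconductivity.Theorems.DispersionFlow

/-- **THE GATE LEMMA KEYED BY `FrameOK` IN THE KL REGIME (pointwise form).**  For every `R` (`Gfr ≥ 0`) there are volume/β/U/frame-free
`c₃, U₀ > 0`, `Λ_K ≥ 0`, `r₀ > 0` such that in the regime, for every `μ ∈ klWindowC`, every frame with `FrameOK R U (nScales β) μ K`, every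
volume `L ≥ max(20, 8π/klFlatR)` with `2π/L < r₀`, every `M`, `n`, angular Lipschitz constant `Λ_ν` of `ν_n(K)`, sup-metric Lipschitz constant
`Λ_ℓ` of `Σ_{i ≤ n} ℓ_i^G(K)` and every `θ`:
`|ν_n(K)(θ)| ≤ |K(q_θ) + Σ_{i ≤ n} ℓ_i^G(K)(q_θ)| + Λ_ℓ·2π/L + (Λ_ν + Λ_K)·π·(2π/L)/r₀` (`q_θ = klFermiPoint μ K θ`). -/
theorem abs_klLocalPart_le_of_partialSum_frameOK (R : RenConsts) (hR : ∀ j, 0 ≤ R.Gfr j) :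
    ∃ c₃ : ℝ, 0 < c₃ ∧ ∃ U₀ : ℝ, 0 < U₀ ∧ ∃ ΛK : ℝ, 0 ≤ ΛK ∧ ∃ r₀ : ℝ, 0 < r₀ ∧
      ∀ c : ℝ, 0 < c → c ≤ c₃ → ∀ U : ℝ, 0 < U → U ≤ U₀ → ∀ β : ℝ, klBetaMin ≤ β → β ≤ Real.exp (c / U ^ 2) →
      ∀ μ ∈ klWindowC, ∀ K : TrigPolyC4v, FrameOK R U (nScales β) μ K →
      ∀ (L M : ℕ) [NeZero L] [NeZero M], (20 : ℝ) ≤ L → 8 * π / klFlatR ≤ L → 2 * π / L < r₀ →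
      ∀ (n : ℕ) (Λν : ℝ), 0 ≤ Λν →
        (∀ a' b', |klLocalPart L M β U μ K n a' - klLocalPart L M β U μ K n b'| ≤ Λν * |a' - b'|) →
      ∀ Λℓ : ℝ, 0 ≤ Λℓ →
        (∀ p p' : Fin 2 → ℝ, |∑ i ∈ range (n + 1), (klTwoLegPieceG L M β U μ K i).eval p -
          ∑ i ∈ range (n + 1), (klTwoLegPieceG L M β U μ K i).eval p'| ≤ Λℓ * (|p 0 - p' 0| + |p 1 - p' 1|)) →
      ∀ θ : ℝ, |klLocalPart L M β U μ K n θ| ≤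
        |K.eval (klFermiPoint μ K θ) + ∑ i ∈ range (n + 1), (klTwoLegPieceG L M β U μ K i).eval (klFermiPoint μ K θ)| +
          (Λℓ * (2 * π / L) + (Λν + ΛK) * π * (2 * (π / L) / r₀)) := by
  have ha : (-4 : ℝ) < -1.1 := by norm_num
  have hab : (-1.1 : ℝ) ≤ -0.1 := by norm_num
  have hb : (-0.1 : ℝ) < 0 := by norm_num
  set B := bandBounds ha hab hb with hBdef
  have hDt := B.Dtmin_pos
  set κ : ℝ := min B.Dtmin (1 / 10) with hκdef
  have hκ : 0 < κ := lt_min hDt (by norm_num)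
  obtain ⟨c₃, hc₃, U₀, hU₀, hthr⟩ := frame_thresholds hR hκ
  set Λ : ℝ := π * Real.sqrt 2 * (1 + (4 + B.Dtmin) / (B.Dtmin / 2)) with hΛdef
  have hΛ0 : 0 ≤ Λ := by positivity
  refine ⟨c₃, hc₃, U₀, hU₀, Λ, hΛ0, B.umin, B.umin_pos, ?_⟩
  intro c hc hcle U hU hUle β hβmin hβc μ hμ K hK L M _ _ hL20 hLflat hLu n Λν hΛν hLipν Λℓ hΛℓ hLipℓ θ
  -- the frame hypotheses of part D, from `FrameOK` in the regime
  have hAf : ∀ p : Momentum, ∀ j ≤ 2, ‖iteratedFDeriv ℝ j (frameShift K) p‖ ≤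
      2 * R.Gfr 0 * |U| + 2 * R.Gfr 1 * U ^ 2 + R.Gfr 2 * (c / Real.log 4) := fun p j hj =>
    norm_iteratedFDeriv_frameShift_le_of_frameOK_regime hR hc.le hβmin hβc hK p hj
  set A := 2 * R.Gfr 0 * |U| + 2 * R.Gfr 1 * U ^ 2 + R.Gfr 2 * (c / Real.log 4) with hAdef
  have h4A : 4 * A ≤ κ := hthr c U hc.le hcle hU hUle
  have hA0 : 0 ≤ A := le_trans (norm_nonneg _) (hAf 0 0 (by norm_num))
  have hκDt : κ ≤ B.Dtmin := min_le_left _ _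
  have hκ10 : κ ≤ 1 / 10 := min_le_right _ _
  have hADt : 2 * A < B.Dtmin := by linarith
  have hA40 : A ≤ 1 / 40 := by linarith
  have hA20 : A ≤ 1 / 20 := by linarith
  obtain ⟨hlo, hhi⟩ := PerturbedFermiCurve.klWindowC_margin hμ hA20
  have hμ15 : μ ≤ -0.15 := hμ.2
  -- part D, pointwise, with the `A`-dependent curve constant
  have hD := abs_klLocalPart_le_of_partialSum_frame B hAf hADt hlo hhi L M β U n hμ15 hA40 hL20 hLflat hLu hΛν hLipν
    hΛℓ hLipℓ θ le_rfl
  -- the `A`-dependent constant is below `Λ`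
  have hden : B.Dtmin / 2 ≤ B.Dtmin - 2 * A := by linarith
  have hfrac : (4 + 2 * A) / (B.Dtmin - 2 * A) ≤ (4 + B.Dtmin) / (B.Dtmin / 2) := by
    rw [div_le_div_iff₀ (by linarith) (by linarith)]
    nlinarith
  have hpos : 0 ≤ π * Real.sqrt 2 * (1 + (4 + 2 * A) / (B.Dtmin - 2 * A)) := by
    have : 0 ≤ (4 + 2 * A) / (B.Dtmin - 2 * A) := div_nonneg (by linarith) (by linarith)
    positivity
  have hΛ2 : 2 * A * (π * Real.sqrt 2 * (1 + (4 + 2 * A) / (B.Dtmin - 2 * A))) ≤ Λ := by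
    have h2A : 2 * A ≤ 1 := by linarith
    calc 2 * A * (π * Real.sqrt 2 * (1 + (4 + 2 * A) / (B.Dtmin - 2 * A)))
        ≤ 1 * (π * Real.sqrt 2 * (1 + (4 + 2 * A) / (B.Dtmin - 2 * A))) := mul_le_mul_of_nonneg_right h2A hpos
      _ ≤ Λ := by
          rw [one_mul, hΛdef]
          exact mul_le_mul_of_nonneg_left (by linarith) (by positivity)
  have hLpos : (0 : ℝ) < L := by linarith
  have hw : 0 ≤ π * (2 * (π / L) / B.umin) := by
    have := B.umin_pos
    positivity
  have hmono : (Λν + 2 * A * (π * Real.sqrt 2 * (1 + (4 + 2 * A) / (B.Dtmin - 2 * A)))) * π * (2 * (π / L) / B.umin) ≤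
      (Λν + Λ) * π * (2 * (π / L) / B.umin) := by
    rw [mul_assoc, mul_assoc (Λν + Λ)]
    exact mul_le_mul_of_nonneg_right (by linarith) hw
  linarith

/-- **THE GATE LEMMA KEYED BY `FrameOK` IN THE KL REGIME.**  Same constants as the pointwise form; a UNIFORM sup bound `B₀` of
`K ⊕ Σ_{i ≤ n} ℓ_i^G(K)` and `B₀ + Λ_ℓ·2π/L + (Λ_ν + Λ_K)·π·(2π/L)/r₀ ≤ R′.cr·|U|·Λ_n²/e₀` give `RenormalisedAtF L M β U μ K R′ n` —
the renormalisation of every Picard iterate of the wholesale continuation and the conclusion of the one-volume construction, read off ONE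
sup norm; the frame enters only through `FrameOK R U (nScales β) μ K`. -/
theorem renormalisedAtF_of_partialSum_frameOK (R : RenConsts) (hR : ∀ j, 0 ≤ R.Gfr j) :
    ∃ c₃ : ℝ, 0 < c₃ ∧ ∃ U₀ : ℝ, 0 < U₀ ∧ ∃ ΛK : ℝ, 0 ≤ ΛK ∧ ∃ r₀ : ℝ, 0 < r₀ ∧
      ∀ c : ℝ, 0 < c → c ≤ c₃ → ∀ U : ℝ, 0 < U → U ≤ U₀ → ∀ β : ℝ, klBetaMin ≤ β → β ≤ Real.exp (c / U ^ 2) →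
      ∀ μ ∈ klWindowC, ∀ K : TrigPolyC4v, FrameOK R U (nScales β) μ K →
      ∀ (L M : ℕ) [NeZero L] [NeZero M], (20 : ℝ) ≤ L → 8 * π / klFlatR ≤ L → 2 * π / L < r₀ →
      ∀ (R' : RenConsts) (n : ℕ) (Λν : ℝ), 0 ≤ Λν →
        (∀ a' b', |klLocalPart L M β U μ K n a' - klLocalPart L M β U μ K n b'| ≤ Λν * |a' - b'|) →
      ∀ Λℓ : ℝ, 0 ≤ Λℓ →
        (∀ p p' : Fin 2 → ℝ, |∑ i ∈ range (n + 1), (klTwoLegPieceG L M β U μ K i).eval p -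
          ∑ i ∈ range (n + 1), (klTwoLegPieceG L M β U μ K i).eval p'| ≤ Λℓ * (|p 0 - p' 0| + |p 1 - p' 1|)) →
      ∀ B₀ : ℝ, (∀ q : Fin 2 → ℝ, |K.eval q + ∑ i ∈ range (n + 1), (klTwoLegPieceG L M β U μ K i).eval q| ≤ B₀) →
        B₀ + (Λℓ * (2 * π / L) + (Λν + ΛK) * π * (2 * (π / L) / r₀)) ≤ R'.cr * |U| * klScale klE0 n ^ 2 / klE0 →
        RenormalisedAtF L M β U μ K R' n := by
  obtain ⟨c₃, hc₃, U₀, hU₀, ΛK, hΛK, r₀, hr₀, h⟩ := abs_klLocalPart_le_of_partialSum_frameOK R hR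
  refine ⟨c₃, hc₃, U₀, hU₀, ΛK, hΛK, r₀, hr₀, ?_⟩
  intro c hc hcle U hU hUle β hβmin hβc μ hμ K hK L M _ _ hL20 hLflat hLu R' n Λν hΛν hLipν Λℓ hΛℓ hLipℓ B₀ hB htol θ
  have hθ := h c hc hcle U hU hUle β hβmin hβc μ hμ K hK L M hL20 hLflat hLu n Λν hΛν hLipν Λℓ hΛℓ hLipℓ θ
  linarith [hB (klFermiPoint μ K θ)]

end Summit.HubbardSuperconductivity.HubbardSuperconductivity.Theorems.KLRegimeSplit

end
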